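import Literature.Computability.Complexity.AverageCaseDepthHierarchyBlockProbs
import HarnessLib

/-!
# Typicality is preserved by the RST random projections — the three estimates of §10.1

B. Rossman, R. A. Servedio, L.-Y. Tan, *An average-case depth hierarchy theorem for Boolean
circuits*, arXiv:1504.03398 [RossmanServedioTan2015], §10.1 (pp. 31–34): Definition 14 (typical
restrictions), Proposition 10 (Lemmas 10–12: the lift of `ρ ← R_init` is typical w.h.p.),
Proposition 11 (Lemmas 13–16: typicality yields typicality), and the two estimates (27), (28) in
the proof of Lemma 17 (p. 35–36) at the last stage.

All of these are instances of THREE estimates about one stage `ρ ∼ R(τ)` of the process, for a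
parent gate `g` whose children `(g, i)` are the blocks (a block of `τ` is either already falsified —
it "has a bullet" — or in case 2 of Def. 9), proved here for an arbitrary block law `L`, arbitrary
index types, and abstract two-sided bounds `qlo ≤ q_a ≤ qhi` (RST Lemma 13) on the star
probability of an acceptable block:

* `weight_starCount_ge_le` / `weight_starCount_le_le` (RST Lemmas 10, 14 and eq. (27)) — the number
  `N_g` of children of `g` whose lifted value is `⋆` satisfies
  `P[N_g ≥ W' qhi + Δ] ≤ e^{-Δ²/(4 W' qhi)}` and `P[N_g ≤ K qlo - Δ] ≤ e^{-Δ²/(4 K qlo)}`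
  (`K ≤ |U|`, `U` = the children in case 2), by the Chernoff bounds of the sibling file and the exact branch
  probabilities `q_{g,i}`;
* `weight_detCount_ge_le` (RST Lemmas 12, 16) — among parents `g ∈ B` (children of one grandparent),
  the number of `g` whose own lifted value is already determined is `≥ a` with probability
  `≤ e^{2 |B| p⁺ - a}`, `p⁺ = W' λ + (1 - qlo)^K` (`K ≤ |U_g|` for all `g ∈ B`): a parent is
  determined only if a child drew the all-`∘` branch (probability `λ` each, Lemma 15) or every
  case-2 child drew a bullet (probability `≤ (1 - qlo)^{|U|}`, Remark 6);
* `weight_exists_circ_le` (RST eq. (28)) — some child of `g` drew the all-`∘` branch with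
  probability `≤ W' λ`.

Numbers (`W'`, `qlo`, `qhi`, `λ`, `Δ`, `K`) are arbitrary subject to the displayed hypotheses; the
sibling file on Theorem 1 plugs RST's parameters in.
-/

noncomputable section

namespace Literature.Computability.Complexity

namespace RSTProj

open Finset

namespace BlockLaw

variable (L : BlockLaw) {G : Type*} [Fintype G] [DecidableEq G] {W' w : ℕ}

/-- The blocks of the children of the parent `g` are in order for Def. 9: each is already falsified
under `τ` (has a bullet) or is in case 2 (no bullet, a star, acceptable size). Under a typical `τ`
this holds for every parent (RST Def. 14 (1) with Remark 4). [cite: RossmanServedioTan2015, §10.1 Def. 14 (p. 31)] -/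
def ChildOK (τ : G × Fin W' → Fin w → Option Bool) (g : G) : Prop :=
  ∀ i : Fin W', (∃ j, τ (g, i) j = some (!L.o)) ∨ L.Case2 (τ (g, i))

/-- The children of `g` in case 2 (the undetermined children, `(τ̂_g)^{-1}(⋆)`). [cite: RossmanServedioTan2015, §10.1 Def. 14 (2) (p. 31)] -/
def undet (τ : G × Fin W' → Fin w → Option Bool) (g : G) : Finset (Fin W') :=
  univ.filter fun i => L.Case2 (τ (g, i))

/-- The number of children of `g` whose lifted value under `ρ` is `⋆`: `|(ρ̂_g)^{-1}(⋆)|`. [cite: RossmanServedioTan2015, §10.1 Lemma 14 (p. 33)] -/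
def starCount (g : G) (ρ : G × Fin W' → Fin w → Option Bool) : ℕ :=
  (univ.filter fun i : Fin W' => liftBlock L.o (ρ (g, i)) = none).card

/-- The star probability of the child `i` of `g`: `q_{g,i}` in case 2, `0` for a falsified child. [cite: RossmanServedioTan2015, §10.1 Lemma 15 (p. 34)] -/
def pstar (τ : G × Fin W' → Fin w → Option Bool) (g : G) (i : Fin W') : ℝ :=
  ∑ x ∈ univ.filter (fun x : Fin w → Option Bool => liftBlock L.o x = none), L.ζ (τ (g, i)) x

/-- Standing hypotheses on the block law for the estimates of this file: `0 < t ≤ 1`, `0 ≤ λ`,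
`0 ≤ qlo ≤ q_a ≤ qhi ≤ 1 - λ` at acceptable sizes. [cite: RossmanServedioTan2015, §10.1 Lemma 13 (p. 32, `q_a = q (1 ± 2 t_k w^{β})`)] -/
structure LawBounds (L : BlockLaw) (qlo qhi : ℝ) : Prop where
  /-- star probabilities are positive -/
  t_pos : 0 < L.t
  /-- star probabilities are probabilities -/
  t_le_one : L.t ≤ 1
  /-- `λ ≥ 0` -/
  lam_nonneg : 0 ≤ L.lam
  /-- `qlo ≥ 0` -/
  qlo_nonneg : 0 ≤ qlo
  /-- `qlo ≤ qhi` -/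
  qlo_le_qhi : qlo ≤ qhi
  /-- two-sided bound on `q_a` at acceptable sizes -/
  qa_mem : ∀ n, L.acc n = true → 1 ≤ n → qlo ≤ L.qa n ∧ L.qa n ≤ qhi
  /-- `qhi ≤ 1 - λ` (so that the third branch has nonnegative probability) -/
  qhi_le : qhi ≤ 1 - L.lam

variable {L} {qlo qhi : ℝ}

/-- Under the standing hypotheses the block weights are nonnegative. [folklore] -/
theorem LawBounds.ζ_nonneg (h : LawBounds L qlo qhi) (τa ϱ : Fin w → Option Bool) : 0 ≤ L.ζ τa ϱ :=
  L.ζ_nonneg h.t_pos h.t_le_one h.lam_nonneg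
    (fun n hn h1 => ⟨h.qlo_nonneg.trans (h.qa_mem n hn h1).1, (h.qa_mem n hn h1).2.trans h.qhi_le⟩) τa ϱ

omit [Fintype G] [DecidableEq G] in
/-- The star probability of a falsified child is `0`. [cite: RossmanServedioTan2015, §7.2 Remark 4 (p. 18)] -/
theorem pstar_of_bullet (h : LawBounds L qlo qhi) {τ : G × Fin W' → Fin w → Option Bool} {g : G} {i : Fin W'}
    (hb : ∃ j, τ (g, i) j = some (!L.o)) : L.pstar τ g i = 0 := by
  classical
  unfold pstar
  refine le_antisymm ?_ (Finset.sum_nonneg fun x _ => h.ζ_nonneg _ _)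
  calc ∑ x ∈ univ.filter (fun x : Fin w → Option Bool => liftBlock L.o x = none), L.ζ (τ (g, i)) x
      ≤ ∑ x ∈ univ.filter (fun x : Fin w → Option Bool => liftBlock L.o x ≠ some (!L.o)), L.ζ (τ (g, i)) x := by
        refine Finset.sum_le_sum_of_subset_of_nonneg (fun x hx => ?_) fun x _ _ => h.ζ_nonneg _ _
        rw [Finset.mem_filter] at hx ⊢
        exact ⟨hx.1, by rw [hx.2]; exact (Option.some_ne_none _).symm⟩
    _ = 0 := L.weight_lift_ne_bullet_of_bullet hb

omit [Fintype G] [DecidableEq G] in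
/-- The star probability of a case-2 child is `q_a`. [cite: RossmanServedioTan2015, §10.1 Lemma 15 (p. 34)] -/
theorem pstar_of_case2 (h : LawBounds L qlo qhi) {τ : G × Fin W' → Fin w → Option Bool} {g : G} {i : Fin W'}
    (hc : L.Case2 (τ (g, i))) : L.pstar τ g i = L.qa (stars (τ (g, i))).card :=
  L.weight_lift_none h.t_pos h.t_le_one hc

omit [Fintype G] [DecidableEq G] in
/-- The star probabilities lie in `[0, qhi]`, and in `[qlo, qhi]` for case-2 children. [cite: RossmanServedioTan2015, §10.1 Lemmas 13, 15 (pp. 32–34)] -/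
theorem pstar_mem (h : LawBounds L qlo qhi) {τ : G × Fin W' → Fin w → Option Bool} {g : G} (hg : L.ChildOK τ g)
    (i : Fin W') : 0 ≤ L.pstar τ g i ∧ L.pstar τ g i ≤ qhi ∧ (L.Case2 (τ (g, i)) → qlo ≤ L.pstar τ g i) := by
  rcases hg i with hb | hc
  · rw [L.pstar_of_bullet h hb]
    refine ⟨le_rfl, h.qlo_nonneg.trans h.qlo_le_qhi, fun hc => ?_⟩
    obtain ⟨j, hj⟩ := hb
    exact absurd hj (hc.1 j)
  · have hn : 1 ≤ (stars (τ (g, i))).card := Nat.one_le_iff_ne_zero.2 hc.2.2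
    obtain ⟨hlo, hhi⟩ := h.qa_mem _ hc.2.1 hn
    rw [L.pstar_of_case2 h hc]
    exact ⟨h.qlo_nonneg.trans hlo, hhi, fun _ => hlo⟩

/-! ### Estimate 1: the number of starred children of a parent (RST Lemmas 10, 14, eq. (27)) -/

/-- The exponential moments of the star count factorise over the children. [cite: RossmanServedioTan2015, §10.1 Lemma 14 (p. 33, "it follows from Fact 1")] -/
theorem mgf_starCount (h : LawBounds L qlo qhi) (τ : G × Fin W' → Fin w → Option Bool) (g : G) (θ : ℝ) :
    ∑ ρ : G × Fin W' → Fin w → Option Bool, L.R τ ρ * Real.exp (θ * (L.starCount g ρ : ℕ)) =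
      ∏ i : Fin W', (1 + L.pstar τ g i * (Real.exp θ - 1)) := by
  classical
  let emb : Fin W' ↪ G × Fin W' := ⟨fun i => (g, i), fun i j hij => by simpa using hij⟩
  have key := mgf_count_blocks (A := G × Fin W') (X := Fin w → Option Bool) (fun a x => L.ζ (τ a) x)
    (fun a => L.sum_ζ h.t_pos h.t_le_one (τ a)) ((univ : Finset (Fin W')).map emb)
    (fun _ x => liftBlock L.o x = none) θ
  have hcount : ∀ ρ : G × Fin W' → Fin w → Option Bool,
      (((univ : Finset (Fin W')).map emb).filter fun b => liftBlock L.o (ρ b) = none).card = L.starCount g ρ := by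
    intro ρ
    rw [Finset.filter_map, Finset.card_map]; rfl
  simp only [hcount] at key
  rw [show (fun ρ : G × Fin W' → Fin w → Option Bool => L.R τ ρ * Real.exp (θ * (L.starCount g ρ : ℕ))) =
      fun ρ => (∏ a, L.ζ (τ a) (ρ a)) * Real.exp (θ * (L.starCount g ρ : ℕ)) from rfl]
  rw [key, Finset.prod_map]
  rfl

/-- **Upper tail of the star count** (RST Lemma 14, upper half; Lemma 10 for `R_init`):
`P[N_g ≥ W' qhi + Δ] ≤ e^{-Δ²/(4 W' qhi)}` for `0 ≤ Δ ≤ 2 W' qhi`. [cite: RossmanServedioTan2015, §10.1 Lemmas 10, 14 (pp. 32–33)] -/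
theorem weight_starCount_ge_le (h : LawBounds L qlo qhi) {τ : G × Fin W' → Fin w → Option Bool} {g : G}
    (hg : L.ChildOK τ g) (hM : 0 < (W' : ℝ) * qhi) {Δ : ℝ} (hΔ0 : 0 ≤ Δ) (hΔ : Δ ≤ 2 * (W' * qhi)) :
    ∑ ρ ∈ univ.filter (fun ρ : G × Fin W' → Fin w → Option Bool => W' * qhi + Δ ≤ (L.starCount g ρ : ℕ)), L.R τ ρ ≤
      Real.exp (-(Δ ^ 2 / (4 * (W' * qhi)))) := by
  classical
  refine weight_ge_le_of_mgf (L.R τ) (fun ρ => Finset.prod_nonneg fun a _ => h.ζ_nonneg _ _) (fun ρ => L.starCount g ρ)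
    (univ : Finset (Fin W')) (L.pstar τ g) (fun i _ => (L.pstar_mem h hg i).1) (L.mgf_starCount h τ g) hM ?_ hΔ0 hΔ
  calc ∑ i, L.pstar τ g i ≤ ∑ _i : Fin W', qhi := Finset.sum_le_sum fun i _ => (L.pstar_mem h hg i).2.1
    _ = W' * qhi := by simp

/-- **Lower tail of the star count** (RST Lemma 14, lower half; Lemma 10; eq. (27)):
`P[N_g ≤ K qlo - Δ] ≤ e^{-Δ²/(4 K qlo)}` for `0 ≤ Δ ≤ 2 K qlo`, whenever at least `K > 0` children are in
case 2. [cite: RossmanServedioTan2015, §10.1 Lemmas 10, 14 (pp. 32–33) and eq. (27) (p. 35)] -/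
theorem weight_starCount_le_le (h : LawBounds L qlo qhi) {τ : G × Fin W' → Fin w → Option Bool} {g : G}
    (hg : L.ChildOK τ g) {K : ℝ} (hK : K ≤ (L.undet τ g).card) (hM : 0 < K * qlo) {Δ : ℝ} (hΔ0 : 0 ≤ Δ)
    (hΔ : Δ ≤ 2 * (K * qlo)) :
    ∑ ρ ∈ univ.filter (fun ρ : G × Fin W' → Fin w → Option Bool => ((L.starCount g ρ : ℕ) : ℝ) ≤ K * qlo - Δ), L.R τ ρ ≤
      Real.exp (-(Δ ^ 2 / (4 * (K * qlo)))) := by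
  classical
  refine weight_le_le_of_mgf (L.R τ) (fun ρ => Finset.prod_nonneg fun a _ => h.ζ_nonneg _ _) (fun ρ => L.starCount g ρ)
    (univ : Finset (Fin W')) (L.pstar τ g) (fun i _ => ?_) (L.mgf_starCount h τ g) hM ?_ hΔ0 hΔ
  · exact ((L.pstar_mem h hg i).2.1.trans h.qhi_le).trans (by linarith [h.lam_nonneg])
  · calc K * qlo ≤ ((L.undet τ g).card : ℝ) * qlo := mul_le_mul_of_nonneg_right hK h.qlo_nonneg
      _ = ∑ _i ∈ L.undet τ g, qlo := by simp
      _ ≤ ∑ i ∈ L.undet τ g, L.pstar τ g i :=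
          Finset.sum_le_sum fun i hi => (L.pstar_mem h hg i).2.2 (Finset.mem_filter.1 hi).2
      _ ≤ ∑ i, L.pstar τ g i :=
          Finset.sum_le_sum_of_subset_of_nonneg (Finset.filter_subset _ _) fun i _ _ => (L.pstar_mem h hg i).1

/-! ### Estimate 3: some child drew the all-`∘` branch (RST eq. (28)) -/

omit [Fintype G] [DecidableEq G] in
/-- The probability that the child `i` of `g` drew the all-`∘` branch is `λ` in case 2, `0` for a
falsified child; so at most `λ`. [cite: RossmanServedioTan2015, §10.1 Lemma 15 (p. 34)] -/
theorem weight_circ_le (h : LawBounds L qlo qhi) {τ : G × Fin W' → Fin w → Option Bool} {g : G} (hg : L.ChildOK τ g)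
    (i : Fin W') :
    ∑ x ∈ univ.filter (fun x : Fin w → Option Bool => liftBlock L.o x = some L.o), L.ζ (τ (g, i)) x ≤ L.lam := by
  classical
  rcases hg i with hb | hc
  · calc ∑ x ∈ univ.filter (fun x : Fin w → Option Bool => liftBlock L.o x = some L.o), L.ζ (τ (g, i)) x
        ≤ ∑ x ∈ univ.filter (fun x : Fin w → Option Bool => liftBlock L.o x ≠ some (!L.o)), L.ζ (τ (g, i)) x := by
          refine Finset.sum_le_sum_of_subset_of_nonneg (fun x hx => ?_) fun x _ _ => h.ζ_nonneg _ _
          rw [Finset.mem_filter] at hx ⊢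
          refine ⟨hx.1, ?_⟩
          rw [hx.2]
          exact fun e => Bool.not_ne_self L.o (Option.some.inj e).symm
      _ = 0 := L.weight_lift_ne_bullet_of_bullet hb
      _ ≤ L.lam := h.lam_nonneg
  · exact le_of_eq (L.weight_lift_circ hc)

/-- **Some child drew the all-`∘` branch** (making the parent's value controlling for ITS parent)
with probability at most `W' λ` (RST eq. (28): `Pr[ρ̂ ∉ {0,⋆}^{w₀}] ≤ λ w₀`). [cite: RossmanServedioTan2015, §10.2 eq. (28) (p. 35)] -/
theorem weight_exists_circ_le (h : LawBounds L qlo qhi) {τ : G × Fin W' → Fin w → Option Bool} {g : G}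
    (hg : L.ChildOK τ g) :
    ∑ ρ ∈ univ.filter (fun ρ : G × Fin W' → Fin w → Option Bool => ∃ i : Fin W', liftBlock L.o (ρ (g, i)) = some L.o),
        L.R τ ρ ≤ W' * L.lam := by
  classical
  let emb : Fin W' ↪ G × Fin W' := ⟨fun i => (g, i), fun i j hij => by simpa using hij⟩
  have key := weight_exists_le_sum (A := G × Fin W') (X := Fin w → Option Bool) (fun a x => L.ζ (τ a) x)
    (fun a x => h.ζ_nonneg _ _) (fun a => L.sum_ζ h.t_pos h.t_le_one (τ a)) ((univ : Finset (Fin W')).map emb)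
    (fun _ x => liftBlock L.o x = some L.o)
  have e : univ.filter (fun ρ : G × Fin W' → Fin w → Option Bool => ∃ i : Fin W', liftBlock L.o (ρ (g, i)) = some L.o) =
      univ.filter (fun ρ : G × Fin W' → Fin w → Option Bool =>
        ∃ b ∈ (univ : Finset (Fin W')).map emb, liftBlock L.o (ρ b) = some L.o) := by
    ext ρ; simp [emb]
  rw [show (fun ρ : G × Fin W' → Fin w → Option Bool => L.R τ ρ) = fun ρ => ∏ a, L.ζ (τ a) (ρ a) from rfl] at *
  rw [e]
  refine key.trans ?_
  rw [Finset.sum_map]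
  calc ∑ i : Fin W', ∑ x ∈ univ.filter (fun x : Fin w → Option Bool => liftBlock L.o x = some L.o), L.ζ (τ (emb i)) x
      ≤ ∑ _i : Fin W', L.lam := Finset.sum_le_sum fun i _ => L.weight_circ_le h hg i
    _ = W' * L.lam := by simp

/-! ### Estimate 2: the number of determined parents (RST Lemmas 12, 16) -/

/-- The parent `g` (a gate of non-controlling value `!L.o`) is determined under the lifted
restriction: its lifted-lifted value is not `⋆`. [cite: RossmanServedioTan2015, §10.1 Lemma 15 (p. 34, `ρ̂̂_a`)] -/
def Det (g : G) (ρ : G × Fin W' → Fin w → Option Bool) : Prop :=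
  liftBlock (!L.o) (fun i : Fin W' => liftBlock L.o (ρ (g, i))) ≠ none

/-- Decidability of `Det`. [folklore] -/
instance (g : G) (ρ : G × Fin W' → Fin w → Option Bool) : Decidable (L.Det g ρ) :=
  inferInstanceAs (Decidable (_ ≠ _))

omit [Fintype G] [DecidableEq G] in
/-- A determined parent has a controlling child or all children non-controlling. [folklore] -/
theorem Det.cases {g : G} {ρ : G × Fin W' → Fin w → Option Bool} (hd : L.Det g ρ) :
    (∃ i, liftBlock L.o (ρ (g, i)) = some L.o) ∨ (∀ i, liftBlock L.o (ρ (g, i)) = some (!L.o)) := by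
  unfold Det liftBlock at hd
  simp only [Bool.not_not] at hd
  split_ifs at hd with h1 h2
  · exact Or.inl h1
  · exact Or.inr h2
  · exact absurd rfl hd

omit [Fintype G] [DecidableEq G] in
/-- **The probability that a parent is determined** is at most `W' λ + (1 - qlo)^{|U|}`: a
controlling child (all-`∘` branch, `λ` each) or bullets in all case-2 children (`≤ 1 - qlo` each,
independently). [cite: RossmanServedioTan2015, §10.1 Lemma 15 and Remark 6 (p. 34)] -/
theorem weight_det_le (h : LawBounds L qlo qhi) (hq1 : qlo ≤ 1) {τ : G × Fin W' → Fin w → Option Bool} {g : G}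
    (hg : L.ChildOK τ g) :
    ∑ xs ∈ univ.filter (fun xs : Fin W' → Fin w → Option Bool =>
        liftBlock (!L.o) (fun i => liftBlock L.o (xs i)) ≠ none), ∏ i, L.ζ (τ (g, i)) (xs i) ≤
      W' * L.lam + (1 - qlo) ^ (L.undet τ g).card := by
  classical
  have hν0 : ∀ xs : Fin W' → Fin w → Option Bool, 0 ≤ ∏ i, L.ζ (τ (g, i)) (xs i) :=
    fun xs => Finset.prod_nonneg fun i _ => h.ζ_nonneg _ _
  have hζ1 : ∀ i : Fin W', ∑ x, L.ζ (τ (g, i)) x = 1 := fun i => L.sum_ζ h.t_pos h.t_le_one _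
  -- the two sub-events
  let EA : (Fin W' → Fin w → Option Bool) → Prop := fun xs => ∃ i ∈ (univ : Finset (Fin W')), liftBlock L.o (xs i) = some L.o
  let EB : (Fin W' → Fin w → Option Bool) → Prop := fun xs => ∀ i ∈ (univ : Finset (Fin W')), liftBlock L.o (xs i) = some (!L.o)
  have hsub : univ.filter (fun xs : Fin W' → Fin w → Option Bool => liftBlock (!L.o) (fun i => liftBlock L.o (xs i)) ≠ none) ⊆
      univ.filter EA ∪ univ.filter EB := by
    intro xs hxs
    have hd : L.Det g (fun gi => xs gi.2) := (Finset.mem_filter.1 hxs).2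
    rw [Finset.mem_union, Finset.mem_filter, Finset.mem_filter]
    rcases hd.cases with ⟨i, hi⟩ | hall
    · exact Or.inl ⟨Finset.mem_univ _, i, Finset.mem_univ _, hi⟩
    · exact Or.inr ⟨Finset.mem_univ _, fun i _ => hall i⟩
  have hA : ∑ xs ∈ univ.filter EA, ∏ i, L.ζ (τ (g, i)) (xs i) ≤ W' * L.lam := by
    have key := weight_exists_le_sum (A := Fin W') (X := Fin w → Option Bool) (fun i x => L.ζ (τ (g, i)) x)
      (fun i x => h.ζ_nonneg _ _) hζ1 univ (fun _ x => liftBlock L.o x = some L.o)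
    have bound : ∑ i ∈ (univ : Finset (Fin W')),
        ∑ x ∈ univ.filter (fun x : Fin w → Option Bool => liftBlock L.o x = some L.o), L.ζ (τ (g, i)) x ≤ W' * L.lam := by
      calc ∑ i : Fin W', ∑ x ∈ univ.filter (fun x : Fin w → Option Bool => liftBlock L.o x = some L.o), L.ζ (τ (g, i)) x
          ≤ ∑ _i : Fin W', L.lam := Finset.sum_le_sum fun i _ => L.weight_circ_le h hg i
        _ = W' * L.lam := by simp
    refine le_trans (le_of_eq (Finset.sum_congr ?_ fun _ _ => rfl)) (key.trans bound)
    ext xs; simp [EA]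
  have hB : ∑ xs ∈ univ.filter EB, ∏ i, L.ζ (τ (g, i)) (xs i) ≤ (1 - qlo) ^ (L.undet τ g).card := by
    have key := weight_forall_eq_prod (A := Fin W') (X := Fin w → Option Bool) (fun i x => L.ζ (τ (g, i)) x) hζ1
      univ (fun _ x => liftBlock L.o x = some (!L.o))
    have e2 : ∑ xs ∈ univ.filter EB, ∏ i, L.ζ (τ (g, i)) (xs i) =
        ∏ b ∈ (univ : Finset (Fin W')), ∑ x ∈ univ.filter (fun x : Fin w → Option Bool => liftBlock L.o x = some (!L.o)), L.ζ (τ (g, b)) x := by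
      rw [← key, Finset.sum_filter]
      refine Finset.sum_congr rfl fun xs _ => ?_
      by_cases hx : EB xs
      · have hx' : ∀ b ∈ (univ : Finset (Fin W')), liftBlock L.o (xs b) = some (!L.o) := hx
        rw [if_pos hx, if_pos hx', mul_one]
      · have hx' : ¬ ∀ b ∈ (univ : Finset (Fin W')), liftBlock L.o (xs b) = some (!L.o) := hx
        rw [if_neg hx, if_neg hx', mul_zero]
    rw [e2]
    -- each factor is `≤ 1`, and `≤ 1 - qlo` on the case-2 children
    have hfac1 : ∀ i : Fin W', ∑ x ∈ univ.filter (fun x : Fin w → Option Bool => liftBlock L.o x = some (!L.o)), L.ζ (τ (g, i)) x ≤ 1 :=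
      fun i => (Finset.sum_le_sum_of_subset_of_nonneg (Finset.filter_subset _ _) fun x _ _ => h.ζ_nonneg _ _).trans (le_of_eq (hζ1 i))
    have hfac0 : ∀ i : Fin W', 0 ≤ ∑ x ∈ univ.filter (fun x : Fin w → Option Bool => liftBlock L.o x = some (!L.o)), L.ζ (τ (g, i)) x :=
      fun i => Finset.sum_nonneg fun x _ => h.ζ_nonneg _ _
    have hfacU : ∀ i ∈ L.undet τ g,
        ∑ x ∈ univ.filter (fun x : Fin w → Option Bool => liftBlock L.o x = some (!L.o)), L.ζ (τ (g, i)) x ≤ 1 - qlo := by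
      intro i hi
      have hc : L.Case2 (τ (g, i)) := (Finset.mem_filter.1 hi).2
      rw [L.weight_lift_bullet h.t_pos h.t_le_one hc]
      have hn : 1 ≤ (stars (τ (g, i))).card := Nat.one_le_iff_ne_zero.2 hc.2.2
      have := (h.qa_mem _ hc.2.1 hn).1
      linarith [h.lam_nonneg]
    rw [← Finset.prod_filter_mul_prod_filter_not univ (fun i => L.Case2 (τ (g, i)))]
    have h1 : ∏ i ∈ univ.filter (fun i => L.Case2 (τ (g, i))),
        ∑ x ∈ univ.filter (fun x : Fin w → Option Bool => liftBlock L.o x = some (!L.o)), L.ζ (τ (g, i)) x ≤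
        (1 - qlo) ^ (L.undet τ g).card := by
      calc ∏ i ∈ univ.filter (fun i => L.Case2 (τ (g, i))),
            ∑ x ∈ univ.filter (fun x : Fin w → Option Bool => liftBlock L.o x = some (!L.o)), L.ζ (τ (g, i)) x
          ≤ ∏ _i ∈ univ.filter (fun i => L.Case2 (τ (g, i))), (1 - qlo) :=
            Finset.prod_le_prod (fun i _ => hfac0 i) fun i hi => hfacU i hi
        _ = (1 - qlo) ^ (L.undet τ g).card := by rw [Finset.prod_const]; rfl
    have h2 : ∏ i ∈ univ.filter (fun i => ¬ L.Case2 (τ (g, i))),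
        ∑ x ∈ univ.filter (fun x : Fin w → Option Bool => liftBlock L.o x = some (!L.o)), L.ζ (τ (g, i)) x ≤ 1 :=
      Finset.prod_le_one (fun i _ => hfac0 i) fun i _ => hfac1 i
    calc _ ≤ (1 - qlo) ^ (L.undet τ g).card * 1 :=
          mul_le_mul h1 h2 (Finset.prod_nonneg fun i _ => hfac0 i) (pow_nonneg (by linarith) _)
      _ = _ := mul_one _
  calc ∑ xs ∈ univ.filter (fun xs : Fin W' → Fin w → Option Bool => liftBlock (!L.o) (fun i => liftBlock L.o (xs i)) ≠ none),
        ∏ i, L.ζ (τ (g, i)) (xs i)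
      ≤ ∑ xs ∈ univ.filter EA ∪ univ.filter EB, ∏ i, L.ζ (τ (g, i)) (xs i) :=
        Finset.sum_le_sum_of_subset_of_nonneg hsub fun xs _ _ => hν0 xs
    _ ≤ ∑ xs ∈ univ.filter EA, ∏ i, L.ζ (τ (g, i)) (xs i) + ∑ xs ∈ univ.filter EB, ∏ i, L.ζ (τ (g, i)) (xs i) := by
        rw [← Finset.sum_union_inter]
        have : 0 ≤ ∑ xs ∈ univ.filter EA ∩ univ.filter EB, ∏ i, L.ζ (τ (g, i)) (xs i) :=
          Finset.sum_nonneg fun xs _ => hν0 xs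
        linarith
    _ ≤ _ := add_le_add hA hB

/-- The number of determined parents among `B`. [cite: RossmanServedioTan2015, §10.1 Lemma 16 (p. 34, `|(ρ̂̂_α)^{-1}({•,∘})|`)] -/
def detCount (B : Finset G) (ρ : G × Fin W' → Fin w → Option Bool) : ℕ := (B.filter fun g => L.Det g ρ).card

/-- **Upper tail of the number of determined parents** (RST Lemmas 12, 16): if every parent
`g ∈ B` has its children in order and at least `K` of them in case 2, then
`P[detCount B ≥ a] ≤ exp(2 |B| (W' λ + (1 - qlo)^K) - a)`. [cite: RossmanServedioTan2015, §10.1 Lemmas 12, 16 (pp. 32, 34)] -/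
theorem weight_detCount_ge_le (h : LawBounds L qlo qhi) (hq1 : qlo ≤ 1) {τ : G × Fin W' → Fin w → Option Bool}
    (B : Finset G) (hB : ∀ g ∈ B, L.ChildOK τ g) {K : ℕ} (hK : ∀ g ∈ B, K ≤ (L.undet τ g).card) (a : ℝ) :
    ∑ ρ ∈ univ.filter (fun ρ : G × Fin W' → Fin w → Option Bool => a ≤ (L.detCount B ρ : ℕ)), L.R τ ρ ≤
      Real.exp (2 * (B.card * (W' * L.lam + (1 - qlo) ^ K)) - a) := by
  classical
  have hζ1 : ∀ a : G × Fin W', ∑ x, L.ζ (τ a) x = 1 := fun a => L.sum_ζ h.t_pos h.t_le_one _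
  have hmgf := mgf_count_groups (G := G) (I := Fin W') (X := Fin w → Option Bool) (fun a x => L.ζ (τ a) x) hζ1 B
    (fun _ xs => liftBlock (!L.o) (fun i => liftBlock L.o (xs i)) ≠ none)
  set p : G → ℝ := fun g => ∑ xs ∈ univ.filter (fun xs : Fin W' → Fin w → Option Bool =>
    liftBlock (!L.o) (fun i => liftBlock L.o (xs i)) ≠ none), ∏ i, L.ζ (τ (g, i)) (xs i) with hp
  have hp0 : ∀ g ∈ B, 0 ≤ p g := fun g _ => Finset.sum_nonneg fun xs _ => Finset.prod_nonneg fun i _ => h.ζ_nonneg _ _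
  have hple : ∀ g ∈ B, p g ≤ W' * L.lam + (1 - qlo) ^ K := by
    intro g hg
    refine (L.weight_det_le h hq1 (hB g hg)).trans (add_le_add le_rfl ?_)
    exact pow_le_pow_of_le_one (by linarith) (by linarith [h.qlo_nonneg]) (hK g hg)
  refine weight_ge_le_of_mgf_large (L.R τ) (fun ρ => Finset.prod_nonneg fun a _ => h.ζ_nonneg _ _)
    (fun ρ => L.detCount B ρ) B p hp0 (fun θ => ?_) ?_ a
  · have := hmgf θ
    rw [show (fun ρ : G × Fin W' → Fin w → Option Bool => L.R τ ρ * Real.exp (θ * (L.detCount B ρ : ℕ))) =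
        fun ρ => (∏ a, L.ζ (τ a) (ρ a)) * Real.exp (θ * ((B.filter fun g =>
          liftBlock (!L.o) (fun i => liftBlock L.o (ρ (g, i))) ≠ none).card : ℕ)) from rfl]
    rw [this]
  · calc ∑ g ∈ B, p g ≤ ∑ _g ∈ B, (W' * L.lam + (1 - qlo) ^ K) := Finset.sum_le_sum hple
      _ = B.card * (W' * L.lam + (1 - qlo) ^ K) := by rw [Finset.sum_const, nsmul_eq_mul]

end BlockLaw

end RSTProj

end Literature.Computability.Complexity

end
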